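import Summits.ValiantsHypothesis.ValiantsHypothesis.Theorems.LacunarySymmetroidMatrixDescartesDoorA26WallBubblingTwoScaleDoubletonSplit

/-!
# Wall bubbling for `DoorA26` — (W-split) rung 3a: THE TRIPLE CLASS ACROSS TWO SCALES, TOP RULE («t²-slot alive upstream ⇒ nothing confluent downstream»)

HONEST FRAMING.  Chain lemma for obligation (W) `stub_weylFaces` of `Cruxes/DoorA26/Lines/wall_bubbling.lean` (stmt-ValiantsHypothesis-19979
`DoorA26`; OPEN, typed, never asserted), W2 seat val-sym-door-p1 g14; named residual «(W-split) multi-scale linking» (line lead's rev 4, register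
R2761).  Third rung of (W-split) in the kernel, in the two-scale currency of `…TwoScaleMonotone` / `…TwoScaleDoubletonSplit` (p666662 / p667161).

The TRIPLE value `2α` of a generic Weyl face (positions `0, 5`; `δ0 5 = δ0 0`) carries the three frame slots `(0,0)` (degree 0: `polar(U₀+U₅, U₀+U₅)`),
`(0,5)` (degree 1: `polar(U₀+U₅, wU₅)`), `(5,5)` (degree 2: `polar(wU₅, wU₅)`).  The slot-splitting rule `Σ_c deg ≤ 2` of the count `chain_ceiling`
(p663233) has, over TWO clusters, the instances (i) `d = 2 ⇒ d' = 0` and (ii) `d = 1 ⇒ d' ≤ 1` (and mirrors: the same statements for `−δ` and the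
letters recentred at the second cluster), and over THREE clusters the exclusion of `(1,1,1)`.  This file proves (i); the companion
`…TwoScaleTripleMid` proves (ii):

* `triple_top_core` — scalar bookkeeping: upstream `κμ ≤ |g₅₅|`, `|g₀₅|, |g₀₀| ≤ μ`; downstream the `(0,0)` entry `E₀²(g₀₀ + 2Λg₀₅ + Λ²g₅₅)` is
  dominated by `μ'`; if a downstream CONFLUENT triple slot is alive (`κ'μ' ≤ E₀²e²|g₅₅|` or `≤ E₀²e|g₀₅ + Λg₅₅|`, `e = e^{wL}`) and `|Λ| ≥ 1 + 6/κ`,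
  then `|Λ| ≤ (1 + 4/κ')·e`;
* `triple_frameShift` — the three triple entries at the second scale in terms of the first (`frame_shift`);
* **`twoScale_triple_top`** — under the hypotheses of `twoScale_monotone`: `Γ 5 5 ≠ 0 → Γ' 5 5 = 0 ∧ Γ' 0 5 = 0` (the `t²`-slot alive at the first
  scale kills BOTH confluent triple slots at the second), by `eventually_dslope_exp_gt` (`|Λ'|` outgrows `a e^{wL} + b`).

The three-scale exclusion of `(1,1,1)` remains OPEN (memo DOOR-A26-P1G14-SPLIT-CHAINS §4b); the count caps at 20 regardless.  No new definitions;
nothing here bears on `DoorA26`, `MatrixDescartes` (stmt-ValiantsHypothesis-18050) or `VP ≠ VNP`.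

[this work] two-scale bookkeeping of the triple class.
-/
-- `Summit.ValiantsHypothesis.ValiantsHypothesis.…` repeats a component by the D-0017 layout
-- (single-conjunct summit), which the `dupNamespace` linter flags; the name is mandated.
set_option linter.dupNamespace false

namespace Summit.ValiantsHypothesis.ValiantsHypothesis.Theorems.LacunarySymmetroidMatrixDescartes.WallBubbling

open Finset Filter Topology
open Bubbling (polar polar_apply polar_comm polar_smul_left_right)
open scoped BigOperators

/-! ## 1. Scalar core and stage identities -/

/-- Scalar core of the top rule (see the module docstring). [this work] -/
theorem triple_top_core {κ κ' μ μ' Λ e E₀ g₀₀ g₀₅ g₅₅ : ℝ} (hκ : 0 < κ) (hκ' : 0 < κ') (hμ : 0 < μ) (he : 0 < e) (hE₀ : 0 < E₀)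
    (h55 : κ * μ ≤ |g₅₅|) (h05 : |g₀₅| ≤ μ) (h00 : |g₀₀| ≤ μ)
    (hdom : E₀ * E₀ * |g₀₀ + 2 * Λ * g₀₅ + Λ * Λ * g₅₅| ≤ μ')
    (halive : κ' * μ' ≤ E₀ * E₀ * (e * e) * |g₅₅| ∨ κ' * μ' ≤ E₀ * E₀ * e * |g₀₅ + Λ * g₅₅|)
    (hΛ : 1 + 6 / κ ≤ |Λ|) : |Λ| ≤ (1 + 4 / κ') * e := by
  have hg : 0 < |g₅₅| := lt_of_lt_of_le (mul_pos hκ hμ) h55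
  have h6κ : 0 < 6 / κ := by positivity
  have hΛ1 : 1 ≤ |Λ| := by linarith
  have hΛκ : 6 / κ ≤ |Λ| := by linarith
  have hμg : μ ≤ |g₅₅| / κ := by rw [le_div_iff₀ hκ]; linarith
  -- (1) the downstream `(0,0)` entry is at least `Λ²|g₅₅|/2`
  have hlow : Λ * Λ * |g₅₅| / 2 ≤ |g₀₀ + 2 * Λ * g₀₅ + Λ * Λ * g₅₅| := by
    have t1 : |Λ * Λ * g₅₅| - |g₀₀ + 2 * Λ * g₀₅| ≤ |g₀₀ + 2 * Λ * g₀₅ + Λ * Λ * g₅₅| := by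
      have := abs_sub_abs_le_abs_sub (Λ * Λ * g₅₅) (-(g₀₀ + 2 * Λ * g₀₅))
      rw [abs_neg, show Λ * Λ * g₅₅ - -(g₀₀ + 2 * Λ * g₀₅) = g₀₀ + 2 * Λ * g₀₅ + Λ * Λ * g₅₅ by ring] at this
      exact this
    have t2 : |g₀₀ + 2 * Λ * g₀₅| ≤ μ + 2 * |Λ| * μ := by
      have := abs_add_le g₀₀ (2 * Λ * g₀₅)
      rw [abs_mul, abs_mul, abs_two] at this
      nlinarith [abs_nonneg Λ]
    have t3 : |Λ * Λ * g₅₅| = |Λ| * |Λ| * |g₅₅| := by rw [abs_mul, abs_mul]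
    have t4 : μ + 2 * |Λ| * μ ≤ 3 * |Λ| * (|g₅₅| / κ) := by nlinarith
    have t5 : 3 * |Λ| * (|g₅₅| / κ) ≤ |Λ| * |Λ| * |g₅₅| / 2 := by
      have h3 : 3 * (|g₅₅| / κ) ≤ |Λ| * |g₅₅| / 2 := by
        rw [show 3 * (|g₅₅| / κ) = (6 / κ) * |g₅₅| / 2 by ring]
        exact div_le_div_of_nonneg_right (mul_le_mul_of_nonneg_right hΛκ hg.le) (by norm_num)
      nlinarith [abs_nonneg Λ]
    have hΛsq : Λ * Λ = |Λ| * |Λ| := (abs_mul_abs_self Λ).symm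
    calc Λ * Λ * |g₅₅| / 2 = |Λ| * |Λ| * |g₅₅| / 2 := by rw [hΛsq]
      _ ≤ _ := by linarith
  have hP : 0 < E₀ * E₀ * |g₅₅| := by positivity
  have hμ'ge : E₀ * E₀ * (Λ * Λ * |g₅₅| / 2) ≤ μ' := le_trans (mul_le_mul_of_nonneg_left hlow (by positivity)) hdom
  have hΛsq : Λ * Λ = |Λ| * |Λ| := (abs_mul_abs_self Λ).symm
  rcases halive with ha | ha
  · -- (2a) the `t²`-slot downstream: `κ'Λ²/2 ≤ e²`
    have h1 : (κ' * (|Λ| * |Λ|) / 2) * (E₀ * E₀ * |g₅₅|) ≤ (e * e) * (E₀ * E₀ * |g₅₅|) := by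
      have := le_trans (mul_le_mul_of_nonneg_left hμ'ge hκ'.le) ha
      rw [hΛsq] at this
      calc (κ' * (|Λ| * |Λ|) / 2) * (E₀ * E₀ * |g₅₅|) = κ' * (E₀ * E₀ * (|Λ| * |Λ| * |g₅₅| / 2)) := by ring
        _ ≤ E₀ * E₀ * (e * e) * |g₅₅| := this
        _ = (e * e) * (E₀ * E₀ * |g₅₅|) := by ring
    have h2 : κ' * (|Λ| * |Λ|) / 2 ≤ e * e := le_of_mul_le_mul_right h1 hP
    by_contra hc
    push Not at hc
    have hc0 : 0 ≤ (1 + 4 / κ') * e := by positivity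
    have h3 : ((1 + 4 / κ') * e) * ((1 + 4 / κ') * e) < |Λ| * |Λ| := mul_self_lt_mul_self hc0 hc
    have h4 : κ' / 2 * (((1 + 4 / κ') * e) * ((1 + 4 / κ') * e)) = (κ' / 2 + 4 + 8 / κ') * (e * e) := by
      field_simp
      ring
    have h5 : 0 < 8 / κ' := by positivity
    nlinarith [h2, h3, h4, mul_pos he he]
  · -- (2b) the `t`-slot downstream: `κ'Λ²/2 ≤ 2e|Λ|`
    have hb : |g₀₅ + Λ * g₅₅| ≤ 2 * |Λ| * |g₅₅| := by
      have t := abs_add_le g₀₅ (Λ * g₅₅)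
      rw [abs_mul] at t
      have : |g₀₅| ≤ |Λ| * |g₅₅| := by
        refine le_trans h05 (le_trans hμg ?_)
        rw [div_le_iff₀ hκ]
        have : 1 ≤ |Λ| * κ := by
          have := mul_le_mul_of_nonneg_right hΛκ hκ.le
          rw [div_mul_cancel₀ _ hκ.ne'] at this
          nlinarith [mul_nonneg (abs_nonneg Λ) hκ.le]
        nlinarith
      linarith
    have h1 : (κ' * (|Λ| * |Λ|) / 2) * (E₀ * E₀ * |g₅₅|) ≤ (2 * e * |Λ|) * (E₀ * E₀ * |g₅₅|) := by
      have := le_trans (mul_le_mul_of_nonneg_left hμ'ge hκ'.le)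
        (le_trans ha (mul_le_mul_of_nonneg_left hb (by positivity)))
      rw [hΛsq] at this
      calc (κ' * (|Λ| * |Λ|) / 2) * (E₀ * E₀ * |g₅₅|) = κ' * (E₀ * E₀ * (|Λ| * |Λ| * |g₅₅| / 2)) := by ring
        _ ≤ E₀ * E₀ * e * (2 * |Λ| * |g₅₅|) := this
        _ = (2 * e * |Λ|) * (E₀ * E₀ * |g₅₅|) := by ring
    have h2 : κ' * (|Λ| * |Λ|) / 2 ≤ 2 * e * |Λ| := le_of_mul_le_mul_right h1 hP
    have hΛpos : 0 < |Λ| := by linarith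
    have h3 : κ' * |Λ| / 2 ≤ 2 * e := by
      have : (κ' * |Λ| / 2) * |Λ| ≤ (2 * e) * |Λ| := by nlinarith
      exact le_of_mul_le_mul_right this hΛpos
    rw [add_mul, one_mul, div_mul_eq_mul_div]
    have h4 : |Λ| ≤ 4 * e / κ' := by rw [le_div_iff₀ hκ']; nlinarith
    linarith [h4, he.le]

/-- The three frame entries of the triple class at the second scale in terms of the first (from `frame_shift`):
`g'₅₅ = E₀²e²g₅₅`, `g'₀₅ = E₀²e(g₀₅ + Λ'g₅₅)`, `g'₀₀ = E₀²(g₀₀ + 2Λ'g₀₅ + Λ'²g₅₅)` with `E₀ = e^{δ₀L}`, `e = e^{wL}`, `w = δ₅ − δ₀`,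
`Λ' = dslope (y ↦ e^{yL}) 0 w`. [this work] -/
theorem triple_frameShift (δ : Fin 6 → ℝ) (U : Fin 6 → Matrix (Fin 2) (Fin 2) ℝ) (L : ℝ) :
    polar ((δ 5 - δ 0) • (Real.exp (δ 5 * L) • U 5)) ((δ 5 - δ 0) • (Real.exp (δ 5 * L) • U 5))
        = Real.exp (δ 0 * L) * Real.exp (δ 0 * L) * (Real.exp ((δ 5 - δ 0) * L) * Real.exp ((δ 5 - δ 0) * L))
          * polar ((δ 5 - δ 0) • U 5) ((δ 5 - δ 0) • U 5) ∧
    polar (Real.exp (δ 0 * L) • U 0 + Real.exp (δ 5 * L) • U 5) ((δ 5 - δ 0) • (Real.exp (δ 5 * L) • U 5))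
        = Real.exp (δ 0 * L) * Real.exp (δ 0 * L) * Real.exp ((δ 5 - δ 0) * L)
          * (polar (U 0 + U 5) ((δ 5 - δ 0) • U 5)
            + dslope (fun y : ℝ => Real.exp (y * L)) 0 (δ 5 - δ 0) * polar ((δ 5 - δ 0) • U 5) ((δ 5 - δ 0) • U 5)) ∧
    polar (Real.exp (δ 0 * L) • U 0 + Real.exp (δ 5 * L) • U 5) (Real.exp (δ 0 * L) • U 0 + Real.exp (δ 5 * L) • U 5)
        = Real.exp (δ 0 * L) * Real.exp (δ 0 * L)
          * (polar (U 0 + U 5) (U 0 + U 5) + 2 * dslope (fun y : ℝ => Real.exp (y * L)) 0 (δ 5 - δ 0) * polar (U 0 + U 5) ((δ 5 - δ 0) • U 5)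
            + dslope (fun y : ℝ => Real.exp (y * L)) 0 (δ 5 - δ 0) * dslope (fun y : ℝ => Real.exp (y * L)) 0 (δ 5 - δ 0)
              * polar ((δ 5 - δ 0) • U 5) ((δ 5 - δ 0) • U 5)) := by
  have h05' : ((0 : Fin 6) = 5) = False := by simp
  have hs0 := frame_shift δ U L 0
  simp only [h05', if_true, if_false] at hs0
  have hs5 : (δ 5 - δ 0) • (Real.exp (δ 5 * L) • U 5)
      = Real.exp (δ 5 * L) • ((δ 5 - δ 0) • U 5 + (0 : ℝ) • ((δ 5 - δ 0) • U 5)) := by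
    rw [zero_smul, add_zero, smul_comm]
  have he5 : Real.exp (δ 5 * L) = Real.exp (δ 0 * L) * Real.exp ((δ 5 - δ 0) * L) := by
    rw [← Real.exp_add]; congr 1; ring
  refine ⟨?_, ?_, ?_⟩
  · rw [hs5, polar_shift_expand, he5]; ring
  · rw [hs0, hs5, polar_shift_expand, he5]; ring
  · rw [hs0, polar_shift_expand, polar_comm ((δ 5 - δ 0) • U 5) (U 0 + U 5)]; ring
/-! ## 2. The top rule -/

/-- **THE TRIPLE CLASS, TOP RULE (two scales).**  Same letters `U^ν` at two clusters at log-distance `L_ν → +∞` (hypotheses verbatim those of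
`twoScale_monotone`).  If the `t²`-slot `(5,5)` of the triple is alive in the first Gram-normalised limit, then BOTH confluent triple slots `(5,5)` and
`(0,5)` are dead in the second. [this work] -/
theorem twoScale_triple_top (δs : ℕ → Fin 6 → ℝ) (δ0 : Fin 6 → ℝ)
    (hδ : ∀ l, Tendsto (fun ν => δs ν l) atTop (𝓝 (δ0 l))) (h05 : δ0 5 = δ0 0)
    (U : ℕ → Fin 6 → Matrix (Fin 2) (Fin 2) ℝ) (L : ℕ → ℝ) (hL : Tendsto L atTop atTop)
    (μ μ' : ℕ → ℝ) (hμ : ∀ ν, 0 < μ ν) (hμ' : ∀ ν, 0 < μ' ν)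
    (hdom : ∀ ν a b, |polar (if a = 0 then U ν 0 + U ν 5 else if a = 5 then (δs ν 5 - δs ν 0) • U ν 5 else U ν a)
      (if b = 0 then U ν 0 + U ν 5 else if b = 5 then (δs ν 5 - δs ν 0) • U ν 5 else U ν b)| ≤ μ ν)
    (hdom' : ∀ ν a b, |polar
      (if a = 0 then Real.exp (δs ν 0 * L ν) • U ν 0 + Real.exp (δs ν 5 * L ν) • U ν 5
        else if a = 5 then (δs ν 5 - δs ν 0) • (Real.exp (δs ν 5 * L ν) • U ν 5) else Real.exp (δs ν a * L ν) • U ν a)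
      (if b = 0 then Real.exp (δs ν 0 * L ν) • U ν 0 + Real.exp (δs ν 5 * L ν) • U ν 5
        else if b = 5 then (δs ν 5 - δs ν 0) • (Real.exp (δs ν 5 * L ν) • U ν 5) else Real.exp (δs ν b * L ν) • U ν b)| ≤ μ' ν)
    (Γ Γ' : Fin 6 → Fin 6 → ℝ)
    (hΓ : ∀ a b, Tendsto (fun ν => polar (if a = 0 then U ν 0 + U ν 5 else if a = 5 then (δs ν 5 - δs ν 0) • U ν 5 else U ν a)
      (if b = 0 then U ν 0 + U ν 5 else if b = 5 then (δs ν 5 - δs ν 0) • U ν 5 else U ν b) / μ ν) atTop (𝓝 (Γ a b)))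
    (hΓ' : ∀ a b, Tendsto (fun ν => polar
      (if a = 0 then Real.exp (δs ν 0 * L ν) • U ν 0 + Real.exp (δs ν 5 * L ν) • U ν 5
        else if a = 5 then (δs ν 5 - δs ν 0) • (Real.exp (δs ν 5 * L ν) • U ν 5) else Real.exp (δs ν a * L ν) • U ν a)
      (if b = 0 then Real.exp (δs ν 0 * L ν) • U ν 0 + Real.exp (δs ν 5 * L ν) • U ν 5
        else if b = 5 then (δs ν 5 - δs ν 0) • (Real.exp (δs ν 5 * L ν) • U ν 5) else Real.exp (δs ν b * L ν) • U ν b) / μ' ν)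
      atTop (𝓝 (Γ' a b)))
    (h1 : Γ 5 5 ≠ 0) : Γ' 5 5 = 0 ∧ Γ' 0 5 = 0 := by
  set κ : ℝ := |Γ 5 5| / 2 with hκ
  have hκpos : 0 < κ := by rw [hκ]; exact half_pos (abs_pos.mpr h1)
  have h50 : ((5 : Fin 6) = 0) = False := by simp
  have h05' : ((0 : Fin 6) = 5) = False := by simp
  have hw0 : Tendsto (fun ν => δs ν 5 - δs ν 0) atTop (𝓝 0) := by
    have := (hδ 5).sub (hδ 0)
    rw [h05, sub_self] at this
    exact this
  -- upstream data, eventually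
  have e1 : ∀ᶠ ν in atTop, κ * μ ν ≤ |polar ((δs ν 5 - δs ν 0) • U ν 5) ((δs ν 5 - δs ν 0) • U ν 5)| := by
    have h := ((hΓ 5 5).abs).eventually_const_lt (show κ < |Γ 5 5| by rw [hκ]; linarith [abs_pos.mpr h1])
    filter_upwards [h] with ν hν
    simp only [h50, if_false, if_true] at hν
    rw [abs_div, abs_of_pos (hμ ν), lt_div_iff₀ (hμ ν)] at hν
    exact hν.le
  have eb : ∀ᶠ ν in atTop, 0 * Real.exp ((δs ν 5 - δs ν 0) * L ν) + (1 + 6 / κ)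
      < |dslope (fun y : ℝ => Real.exp (y * L ν)) 0 (δs ν 5 - δs ν 0)| :=
    eventually_dslope_exp_gt (fun ν => δs ν 5 - δs ν 0) L hw0 hL 0 (1 + 6 / κ) le_rfl (by positivity)
  -- the common contradiction engine
  have engine : ∀ (a' b' : Fin 6), (a' = 5 ∧ b' = 5) ∨ (a' = 0 ∧ b' = 5) → Γ' a' b' ≠ 0 → False := by
    intro a' b' hab hne
    set κ' : ℝ := |Γ' a' b'| / 2 with hκ'
    have hκ'pos : 0 < κ' := by rw [hκ']; exact half_pos (abs_pos.mpr hne)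
    have e2 : ∀ᶠ ν in atTop, κ' * μ' ν ≤ |polar
        (if a' = 0 then Real.exp (δs ν 0 * L ν) • U ν 0 + Real.exp (δs ν 5 * L ν) • U ν 5
          else if a' = 5 then (δs ν 5 - δs ν 0) • (Real.exp (δs ν 5 * L ν) • U ν 5) else Real.exp (δs ν a' * L ν) • U ν a')
        (if b' = 0 then Real.exp (δs ν 0 * L ν) • U ν 0 + Real.exp (δs ν 5 * L ν) • U ν 5
          else if b' = 5 then (δs ν 5 - δs ν 0) • (Real.exp (δs ν 5 * L ν) • U ν 5) else Real.exp (δs ν b' * L ν) • U ν b')| := by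
      have h := ((hΓ' a' b').abs).eventually_const_lt (show κ' < |Γ' a' b'| by rw [hκ']; linarith [abs_pos.mpr hne])
      filter_upwards [h] with ν hν
      rw [abs_div, abs_of_pos (hμ' ν), lt_div_iff₀ (hμ' ν)] at hν
      exact hν.le
    have ea : ∀ᶠ ν in atTop, (1 + 4 / κ') * Real.exp ((δs ν 5 - δs ν 0) * L ν) + 0
        < |dslope (fun y : ℝ => Real.exp (y * L ν)) 0 (δs ν 5 - δs ν 0)| :=
      eventually_dslope_exp_gt (fun ν => δs ν 5 - δs ν 0) L hw0 hL (1 + 4 / κ') 0 (by positivity) le_rfl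
    have e0 : ∀ᶠ ν in atTop, 0 ≤ L ν := hL.eventually_ge_atTop 0
    have hfalse : ∀ᶠ ν : ℕ in atTop, False := by
      filter_upwards [e1, e2, eb, ea, e0] with ν hν1 hν2 hνb hνa _hν0
      obtain ⟨i55, i05, i00⟩ := triple_frameShift (δs ν) (U ν) (L ν)
      set g55 := polar ((δs ν 5 - δs ν 0) • U ν 5) ((δs ν 5 - δs ν 0) • U ν 5) with hg55
      set g05 := polar (U ν 0 + U ν 5) ((δs ν 5 - δs ν 0) • U ν 5) with hg05
      set g00 := polar (U ν 0 + U ν 5) (U ν 0 + U ν 5) with hg00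
      set Λ := dslope (fun y : ℝ => Real.exp (y * L ν)) 0 (δs ν 5 - δs ν 0) with hΛ
      set E₀ := Real.exp (δs ν 0 * L ν) with hE₀
      set e := Real.exp ((δs ν 5 - δs ν 0) * L ν) with he
      have hE₀pos : 0 < E₀ := Real.exp_pos _
      have hepos : 0 < e := Real.exp_pos _
      have h05le : |g05| ≤ μ ν := by have := hdom ν 0 5; simp only [h50, h05', if_false, if_true] at this; exact this
      have h00le : |g00| ≤ μ ν := by have := hdom ν 0 0; simp only [h05', if_false, if_true] at this; exact this
      have hdom00 : E₀ * E₀ * |g00 + 2 * Λ * g05 + Λ * Λ * g55| ≤ μ' ν := by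
        have := hdom' ν 0 0
        simp only [h05', if_false, if_true] at this
        rw [i00, abs_mul, abs_of_pos (mul_pos hE₀pos hE₀pos)] at this
        exact this
      have halive : κ' * μ' ν ≤ E₀ * E₀ * (e * e) * |g55| ∨ κ' * μ' ν ≤ E₀ * E₀ * e * |g05 + Λ * g55| := by
        rcases hab with ⟨rfl, rfl⟩ | ⟨rfl, rfl⟩
        · left
          simp only [h50, if_false, if_true] at hν2
          rw [i55, abs_mul, abs_of_pos (by positivity)] at hν2
          exact hν2
        · right
          simp only [h50, h05', if_false, if_true] at hν2
          rw [i05, abs_mul, abs_of_pos (by positivity)] at hν2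
          exact hν2
      have hΛge : 1 + 6 / κ ≤ |Λ| := by rw [zero_mul, zero_add] at hνb; exact hνb.le
      have hcore := triple_top_core hκpos hκ'pos (hμ ν) hepos hE₀pos hν1 h05le h00le hdom00 halive hΛge
      rw [add_zero] at hνa
      exact absurd (lt_of_le_of_lt hcore hνa) (lt_irrefl _)
    exact hfalse.exists.elim fun _ h => h
  constructor
  · by_contra h; exact engine 5 5 (Or.inl ⟨rfl, rfl⟩) h
  · by_contra h; exact engine 0 5 (Or.inr ⟨rfl, rfl⟩) h

end Summit.ValiantsHypothesis.ValiantsHypothesis.Theorems.LacunarySymmetroidMatrixDescartes.WallBubbling
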